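import Mathlib
import HarnessLib
import Summits.HubbardSuperconductivity.HubbardSuperconductivity.Theorems.KLProgrammeH10TwoPointLimitPerturbedCountCooper

/-!
# Route `KLProgramme` — crux K1 `H10TwoPointLimit` (stmt-HubbardSuperconductivity-19938):
# acceleration bounds in band coordinates and the Lipschitz constant of the perturbed velocities

Helpers for the remaining (S)-lemmas of the port HOME/prover-p4/PORT-NOTE.md (`even_key`, `diag_strat` on the moving curve): for a
root selection `u` of `{ε₀ + δ = μ}` (`δ ∈ C²` with `|δ| ≤ κ₀`, `‖Dδ‖ ≤ κ₁ < Dt_min`, `‖D(Dδ)‖ ≤ κ₂` on `ℝ²`),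

* `abs_accel_le` — `|X_E''(θ)|, |Y_E''(θ)| ≤ A_E = U₂ + 2U₁ + π√2` (`U₂` = `abs_second_deriv_le`'s bound, `U₁ = (4+κ₁)π√2/(Dt_min - κ₁)`),
  the `A₂` field of the moving curve (the tree's `BandBounds.abs_AX_le/abs_AY_le`);
* `abs_VXE_sub_VXE_le` — `|X_E'(x) - X_E'(y)|, |Y_E'(x) - Y_E'(y)| ≤ A_E |x - y|` (the tree's `abs_bandVX_sub_le`), by the mean value
  theorem on `hasDerivAt_VXE/VYE`.

Everything is PROVED; no definitions. References: BGM 2006 §2.4 Lemma 2.1 (2.41) [cite: BenfattoGiulianiMastropietro2006].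
-/

noncomputable section

namespace Summit.HubbardSuperconductivity.HubbardSuperconductivity.Theorems.PerturbedFermiCurve

set_option linter.dupNamespace false -- summit = problem name (single-conjunct summit), D-0017

open Real Set
open Literature.MathematicalPhysics.QuantumLattice Literature.MathematicalPhysics.QuantumLattice.BandSectorCounting

section Fold

variable {a b : ℝ} (B : BandBounds a b) {δ : (Fin 2 → ℝ) → ℝ} (hδs : ContDiff ℝ 2 δ)
  {κ₀ κ₁ κ₂ μ : ℝ} (hδ : ∀ k : Fin 2 → ℝ, |δ k| ≤ κ₀) (hlo : a ≤ μ - κ₀) (hhi : μ + κ₀ ≤ b)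
  (hκ : ∀ k : Fin 2 → ℝ, ‖fderiv ℝ δ k‖ ≤ κ₁) (hκ₁ : κ₁ < B.Dtmin) (hκ₂ : ∀ k : Fin 2 → ℝ, ‖fderiv ℝ (fderiv ℝ δ) k‖ ≤ κ₂)
  {u : ℝ → ℝ} (hu : ∀ θ, IsBandFermiRadius (μ - δ (u θ • dir θ)) θ (u θ))
include B hδs hδ hlo hhi hκ hκ₁ hκ₂ hu

/-- **Acceleration bounds in band coordinates**: `|X_E''(θ)|, |Y_E''(θ)| ≤ A_E = U₂ + 2U₁ + π√2`. [folklore] -/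
theorem abs_accel_le (θ : ℝ) :
    |deriv (deriv u) θ * Real.cos θ - 2 * deriv u θ * Real.sin θ - u θ * Real.cos θ| ≤
        ((4 + κ₂) * (B.smax + κ₁ * (π * Real.sqrt 2 + 2 * B.smax) / (B.Dtmin - κ₁)) ^ 2 +
            (8 + 2 * κ₁) * ((4 + κ₁) * (π * Real.sqrt 2) / (B.Dtmin - κ₁)) + (4 + κ₁) * (π * Real.sqrt 2)) / (B.Dtmin - κ₁) +
          2 * ((4 + κ₁) * (π * Real.sqrt 2) / (B.Dtmin - κ₁)) + π * Real.sqrt 2 ∧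
      |deriv (deriv u) θ * Real.sin θ + 2 * deriv u θ * Real.cos θ - u θ * Real.sin θ| ≤
        ((4 + κ₂) * (B.smax + κ₁ * (π * Real.sqrt 2 + 2 * B.smax) / (B.Dtmin - κ₁)) ^ 2 +
            (8 + 2 * κ₁) * ((4 + κ₁) * (π * Real.sqrt 2) / (B.Dtmin - κ₁)) + (4 + κ₁) * (π * Real.sqrt 2)) / (B.Dtmin - κ₁) +
          2 * ((4 + κ₁) * (π * Real.sqrt 2) / (B.Dtmin - κ₁)) + π * Real.sqrt 2 := by
  have h2ne : (2 : WithTop ℕ∞) ≠ 0 := by norm_num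
  have hδ' : ∀ k : Fin 2 → ℝ, (∀ i, |k i| ≤ π) → |δ k| ≤ κ₀ := fun k _ => hδ k
  have hκ' : ∀ k : Fin 2 → ℝ, (∀ i, |k i| ≤ π) → ‖fderiv ℝ δ k‖ ≤ κ₁ := fun k _ => hκ k
  have hκ₂' : ∀ k : Fin 2 → ℝ, (∀ i, |k i| ≤ π) → ‖fderiv ℝ (fderiv ℝ δ) k‖ ≤ κ₂ := fun k _ => hκ₂ k
  set U1 := (4 + κ₁) * (π * Real.sqrt 2) / (B.Dtmin - κ₁) with hU1
  have hden : 0 < B.Dtmin - κ₁ := sub_pos.2 hκ₁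
  have hκ₁0 : 0 ≤ κ₁ := (norm_nonneg _).trans (hκ 0)
  have hupos : 0 < u θ := (mem_Ioo_of_shifted B hδ' hlo hhi (hu θ)).1
  have hule : u θ ≤ π * Real.sqrt 2 := root_le_pi_mul_sqrt_two B hδ' hlo hhi hu θ
  have hu1 : |deriv u θ| ≤ U1 := by
    refine (abs_deriv_le B hδs h2ne hδ' hlo hhi hκ' hκ₁ hu θ).trans ?_
    rw [hU1]; exact div_le_div_of_nonneg_right (mul_le_mul_of_nonneg_left hule (by linarith)) hden.le
  have hU10 : 0 ≤ U1 := (abs_nonneg _).trans hu1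
  have hu2b := abs_second_deriv_le B hδs hδ' hlo hhi hκ' hκ₁ hκ₂' hu θ
  have hsθ := Real.abs_sin_le_one θ; have hcθ := Real.abs_cos_le_one θ
  set U2 := ((4 + κ₂) * (B.smax + κ₁ * (π * Real.sqrt 2 + 2 * B.smax) / (B.Dtmin - κ₁)) ^ 2 +
      (8 + 2 * κ₁) * U1 + (4 + κ₁) * (π * Real.sqrt 2)) / (B.Dtmin - κ₁) with hU2
  constructor
  · have e1 : |deriv (deriv u) θ * Real.cos θ| ≤ U2 := by
      rw [abs_mul]; exact (mul_le_of_le_one_right (abs_nonneg _) hcθ).trans hu2b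
    have e2 : |2 * deriv u θ * Real.sin θ| ≤ 2 * U1 := by
      rw [abs_mul, abs_mul, abs_two]
      have := mul_le_mul hu1 hsθ (abs_nonneg _) hU10
      linarith
    have e3 : |u θ * Real.cos θ| ≤ π * Real.sqrt 2 := by
      rw [abs_mul, abs_of_pos hupos]; exact (mul_le_of_le_one_right hupos.le hcθ).trans hule
    have t1 := abs_sub (deriv (deriv u) θ * Real.cos θ - 2 * deriv u θ * Real.sin θ) (u θ * Real.cos θ)
    have t2 := abs_sub (deriv (deriv u) θ * Real.cos θ) (2 * deriv u θ * Real.sin θ)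
    linarith
  · have e1 : |deriv (deriv u) θ * Real.sin θ| ≤ U2 := by
      rw [abs_mul]; exact (mul_le_of_le_one_right (abs_nonneg _) hsθ).trans hu2b
    have e2 : |2 * deriv u θ * Real.cos θ| ≤ 2 * U1 := by
      rw [abs_mul, abs_mul, abs_two]
      have := mul_le_mul hu1 hcθ (abs_nonneg _) hU10
      linarith
    have e3 : |u θ * Real.sin θ| ≤ π * Real.sqrt 2 := by
      rw [abs_mul, abs_of_pos hupos]; exact (mul_le_of_le_one_right hupos.le hsθ).trans hule
    have t1 := abs_sub (deriv (deriv u) θ * Real.sin θ + 2 * deriv u θ * Real.cos θ) (u θ * Real.sin θ)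
    have t2 := abs_add_le (deriv (deriv u) θ * Real.sin θ) (2 * deriv u θ * Real.cos θ)
    linarith

/-- **The perturbed velocities are `A_E`-Lipschitz in the angle.** [folklore] -/
theorem abs_VXE_sub_VXE_le (x y : ℝ) :
    |VXE u x - VXE u y| ≤ (((4 + κ₂) * (B.smax + κ₁ * (π * Real.sqrt 2 + 2 * B.smax) / (B.Dtmin - κ₁)) ^ 2 +
            (8 + 2 * κ₁) * ((4 + κ₁) * (π * Real.sqrt 2) / (B.Dtmin - κ₁)) + (4 + κ₁) * (π * Real.sqrt 2)) / (B.Dtmin - κ₁) +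
          2 * ((4 + κ₁) * (π * Real.sqrt 2) / (B.Dtmin - κ₁)) + π * Real.sqrt 2) * |x - y| ∧
      |VYE u x - VYE u y| ≤ (((4 + κ₂) * (B.smax + κ₁ * (π * Real.sqrt 2 + 2 * B.smax) / (B.Dtmin - κ₁)) ^ 2 +
            (8 + 2 * κ₁) * ((4 + κ₁) * (π * Real.sqrt 2) / (B.Dtmin - κ₁)) + (4 + κ₁) * (π * Real.sqrt 2)) / (B.Dtmin - κ₁) +
          2 * ((4 + κ₁) * (π * Real.sqrt 2) / (B.Dtmin - κ₁)) + π * Real.sqrt 2) * |x - y| := by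
  have h2ne : (2 : WithTop ℕ∞) ≠ 0 := by norm_num
  have hδ' : ∀ k : Fin 2 → ℝ, (∀ i, |k i| ≤ π) → |δ k| ≤ κ₀ := fun k _ => hδ k
  have hκ' : ∀ k : Fin 2 → ℝ, (∀ i, |k i| ≤ π) → ‖fderiv ℝ δ k‖ ≤ κ₁ := fun k _ => hκ k
  have hu2 : ContDiff ℝ 2 u := contDiff_of_isRoot B hδs h2ne hδ' hlo hhi hκ' hκ₁ hu
  have hud : ∀ z, DifferentiableAt ℝ u z := fun z => (hu2.differentiable h2ne) z
  have hud' : ∀ z, DifferentiableAt ℝ (deriv u) z := by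
    have h2 : ContDiff ℝ ((1 : WithTop ℕ∞) + 1) u := by rw [one_add_one_eq_two]; exact hu2
    exact fun z => ((contDiff_succ_iff_deriv.1 h2).2.2.differentiable one_ne_zero) z
  constructor
  · have h := convex_univ.norm_image_sub_le_of_norm_hasDerivWithin_le (f := VXE u)
      (fun z _ => (hasDerivAt_VXE (hud z) (hud' z)).hasDerivWithinAt)
      (fun z _ => by rw [Real.norm_eq_abs]; exact (abs_accel_le B hδs hδ hlo hhi hκ hκ₁ hκ₂ hu z).1) (mem_univ y) (mem_univ x)
    rw [Real.norm_eq_abs, Real.norm_eq_abs] at h; exact h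
  · have h := convex_univ.norm_image_sub_le_of_norm_hasDerivWithin_le (f := VYE u)
      (fun z _ => (hasDerivAt_VYE (hud z) (hud' z)).hasDerivWithinAt)
      (fun z _ => by rw [Real.norm_eq_abs]; exact (abs_accel_le B hδs hδ hlo hhi hκ hκ₁ hκ₂ hu z).2) (mem_univ y) (mem_univ x)
    rw [Real.norm_eq_abs, Real.norm_eq_abs] at h; exact h

end Fold

end Summit.HubbardSuperconductivity.HubbardSuperconductivity.Theorems.PerturbedFermiCurve

end
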